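import Literature.Analysis.FluidPDE.PressurePoissonRegion
import Literature.Analysis.FluidPDE.WholeSpaceIBP
import HarnessLib

/-!
# The slice pressure identity `∫ p Δψ = -∫ D²ψ(u, u)` of a classical Navier–Stokes solution

Analysis/FluidPDE support file (theorems only). For a classical solution `(u, p)` of the
unforced Navier–Stokes system on an open space–time region `O` (`IsClassicalNSSolutionOnRegion`),
the pressure Poisson equation `Δp(t) = −div((u·∇)u)(t)` (`PressurePoissonRegion.lean`) holds
pointwise on `O`; tested against `ψ ∈ C_c^∞(E)` with `{t} × supp ψ ⊆ O` and integrated by parts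
(no boundary terms) it becomes the **weak slice pressure equation**

  `∫ p(t) Δψ = -∫ D²ψ(u(t), u(t))`      (`integral_pressure_mul_laplacian_test`),

the form in which the local pressure estimates of the tree are fed (Robinson–Rodrigo–Sadowski,
proof of Lemma 15.12, `CKNLocalRegularityRRSPressure`: hypothesis `hid`; Seregin 2014, §6.3). The
fields are globalised by a cutoff `≡ 1` near `supp ψ` (`ClassicalSuitableRegion`), the
integrations by parts are the whole-space identities of `WholeSpaceIBP` (Green's identity, and
`∫ ⟪(v·∇)v, w⟫ + ∫ ⟪v, (v·∇)w⟫ + ∫ div v ⟪v, w⟫ = 0` with `w = ∇ψ`), and incompressibility kills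
the last term.

## References

* J. C. Robinson, J. L. Rodrigo, W. Sadowski, *The Three-Dimensional Navier–Stokes Equations*,
  CUP (2016), proof of Lemma 15.12 (`−Δp = ∂ᵢ∂ⱼ(uᵢuⱼ)` in `Q_ρ`), p. 227.
  [RobinsonRodrigoSadowski2016]
* T. Tao, arXiv:1108.1165 (2011), (8). [Tao2011]
-/

noncomputable section

open Set Function Filter Topology InnerProductSpace MeasureTheory
open scoped RealInnerProductSpace Laplacian ContDiff

namespace Literature.Analysis.FluidPDE

variable {E : Type*} [NormedAddCommGroup E] [InnerProductSpace ℝ E] [FiniteDimensional ℝ E]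
  [MeasurableSpace E] [BorelSpace E]

omit [MeasurableSpace E] [BorelSpace E] in
/-- The gradient of a `C^∞` function is `C^∞`. [folklore] -/
theorem contDiff_gradient_of_contDiff_infty {ψ : E → ℝ} (hψ : ContDiff ℝ ∞ ψ) :
    ContDiff ℝ ∞ (gradient ψ) := by
  have h : gradient ψ = fun x => (InnerProductSpace.toDual ℝ E).symm (fderiv ℝ ψ x) := rfl
  rw [h]
  exact (InnerProductSpace.toDual ℝ E).symm.contDiff.comp (contDiff_infty_iff_fderiv.1 hψ).2

omit [MeasurableSpace E] [BorelSpace E] in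
/-- The gradient of a compactly supported function is compactly supported. [folklore] -/
theorem hasCompactSupport_gradient_of_hasCompactSupport {ψ : E → ℝ} (hψc : HasCompactSupport ψ) :
    HasCompactSupport (gradient ψ) :=
  (hψc.fderiv (𝕜 := ℝ)).comp_left (g := fun L => (InnerProductSpace.toDual ℝ E).symm L)
    (map_zero _)

omit [MeasurableSpace E] [BorelSpace E] in
/-- `⟪v, D(∇ψ)(x) w⟫ = D²ψ(x)(w)(v)`. [folklore] -/
theorem inner_fderiv_gradient_apply_eq_fderiv_fderiv {ψ : E → ℝ} (x v w : E) :
    ⟪v, fderiv ℝ (gradient ψ) x w⟫ = fderiv ℝ (fderiv ℝ ψ) x w v := by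
  have h : gradient ψ = (InnerProductSpace.toDual ℝ E).symm ∘ fderiv ℝ ψ := rfl
  rw [h, LinearIsometryEquiv.comp_fderiv, ContinuousLinearMap.coe_comp, comp_apply,
    real_inner_comm]
  exact InnerProductSpace.toDual_symm_apply

/-- **`∫ ⟪(v·∇)v, ∇ψ⟫ = -∫ D²ψ(v, v)`** for `v ∈ C¹(E; E)` divergence free on `supp ψ`,
`ψ ∈ C_c^∞(E)` (the tree's trilinear identity `integral_inner_convect_add_eq_zero` with `w = ∇ψ`;
the term `∫ div v ⟪v, ∇ψ⟫` vanishes). [folklore] -/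
theorem integral_inner_convect_gradient_eq_neg {v : E → E} {ψ : E → ℝ} (hv : ContDiff ℝ 1 v)
    (hψ : ContDiff ℝ ∞ ψ) (hψc : HasCompactSupport ψ)
    (hdiv : ∀ x ∈ tsupport ψ, VectorCalculus.divergence v x = 0) :
    ∫ x, ⟪convect v v x, gradient ψ x⟫ = -∫ x, fderiv ℝ (fderiv ℝ ψ) x (v x) (v x) := by
  have hg1 : ContDiff ℝ 1 (gradient ψ) :=
    (contDiff_gradient_of_contDiff_infty hψ).of_le (by exact_mod_cast le_top)
  have h := integral_inner_convect_add_eq_zero hv hv hg1 (hasCompactSupport_gradient_of_hasCompactSupport hψc)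
  have h3 : ∫ x, VectorCalculus.divergence v x * ⟪v x, gradient ψ x⟫ = 0 := by
    refine integral_eq_zero_of_ae (Eventually.of_forall fun x => ?_)
    by_cases hx : x ∈ tsupport ψ
    · simp [hdiv x hx]
    · simp [gradient_eq_zero_of_notMem_tsupport hx]
  have h2 : ∫ x, ⟪v x, convect v (gradient ψ) x⟫ = ∫ x, fderiv ℝ (fderiv ℝ ψ) x (v x) (v x) :=
    integral_congr_ae (Eventually.of_forall fun x => inner_fderiv_gradient_apply_eq_fderiv_fderiv x (v x) (v x))
  rw [h3, add_zero, h2] at h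
  linarith

/-- **Green's second identity without boundary**: `∫ π Δψ = ∫ Δπ ψ` for `π ∈ C²(E)` and
`ψ ∈ C²_c(E)`. [folklore] -/
theorem integral_mul_laplacian_eq_integral_laplacian_mul {π ψ : E → ℝ} (hπ : ContDiff ℝ 2 π)
    (hψ : ContDiff ℝ 2 ψ) (hψc : HasCompactSupport ψ) :
    ∫ x, π x * Δ ψ x = ∫ x, Δ π x * ψ x := by
  set b := stdOrthonormalBasis ℝ E
  have h1 := integral_inner_laplacian_add_eq_zero b hψ (hπ.of_le one_le_two) (Or.inl hψc)
  have h2 := integral_inner_laplacian_add_eq_zero b hπ (hψ.of_le one_le_two) (Or.inr hψc)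
  have hs : ∑ i, ∫ x, ⟪fderiv ℝ ψ x (b i), fderiv ℝ π x (b i)⟫ =
      ∑ i, ∫ x, ⟪fderiv ℝ π x (b i), fderiv ℝ ψ x (b i)⟫ :=
    Finset.sum_congr rfl fun i _ => integral_congr_ae (Eventually.of_forall fun x =>
      real_inner_comm _ _)
  have e1 : ∫ x, π x * Δ ψ x = ∫ x, ⟪(Δ ψ) x, π x⟫ :=
    integral_congr_ae (Eventually.of_forall fun x => by simp)
  have e2 : ∫ x, Δ π x * ψ x = ∫ x, ⟪(Δ π) x, ψ x⟫ :=
    integral_congr_ae (Eventually.of_forall fun x => by simp [mul_comm])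
  rw [e1, e2]
  linarith

/-- **The weak slice pressure equation of a classical solution.** For a classical solution
`(u, p)` of the unforced Navier–Stokes system on an open space–time region `O` (any viscosity),
a time `t` and a test function `ψ ∈ C_c^∞(E)` with `{t} × supp ψ ⊆ O`,
`∫ p(t) Δψ = -∫ D²ψ(u(t), u(t))`. [cite: RobinsonRodrigoSadowski2016, proof of Lemma 15.12, p. 227] -/
theorem integral_pressure_mul_laplacian_test {O : Set (ℝ × E)} (hO : IsOpen O) {ν : ℝ}
    {u : ℝ → E → E} {p : ℝ → E → ℝ} (h : IsClassicalNSSolutionOnRegion O ν 0 u p) {t : ℝ}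
    {ψ : E → ℝ} (hψ : ContDiff ℝ ∞ ψ) (hψc : HasCompactSupport ψ)
    (hK : ∀ x ∈ tsupport ψ, (t, x) ∈ O) :
    ∫ x, p t x * Δ ψ x = -∫ x, fderiv ℝ (fderiv ℝ ψ) x (u t x) (u t x) := by
  -- the section and a cutoff `≡ 1` near `supp ψ`
  have hU : IsOpen (spaceSection O t) := isOpen_spaceSection hO t
  have hKU : tsupport ψ ⊆ spaceSection O t := fun x hx => hK x hx
  obtain ⟨χ, hχs, -, hχU, hχ1⟩ :=
    exists_contDiff_tsupport_subset_eventuallyEq_one hψc hU hKU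
  -- globalised fields
  set V : E → E := fun x => χ x • u t x with hV
  set P : E → ℝ := fun x => χ x • p t x with hP
  have hVs : ContDiff ℝ ∞ V := contDiff_cutoff_smul_of_contDiffOn hU hχs hχU (h.contDiffOn_velocity t)
  have hPs : ContDiff ℝ ∞ P := contDiff_cutoff_smul_of_contDiffOn hU hχs hχU (h.contDiffOn_pressure t)
  -- germs on `supp ψ`
  have hχ1' : ∀ x ∈ tsupport ψ, ∀ᶠ y in 𝓝 x, χ y = 1 := fun x hx =>
    (hχ1.filter_mono (nhds_le_nhdsSet hx))
  have hVg : ∀ x ∈ tsupport ψ, V =ᶠ[𝓝 x] u t := fun x hx => by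
    filter_upwards [hχ1' x hx] with y hy
    simp [hV, hy]
  have hPg : ∀ x ∈ tsupport ψ, P =ᶠ[𝓝 x] p t := fun x hx => by
    filter_upwards [hχ1' x hx] with y hy
    simp [hP, hy]
  -- Step 1: `∫ p Δψ = ∫ P Δψ`
  have e1 : ∫ x, p t x * Δ ψ x = ∫ x, P x * Δ ψ x := by
    refine integral_congr_ae (Eventually.of_forall fun x => ?_)
    beta_reduce
    by_cases hx : x ∈ tsupport ψ
    · rw [(hPg x hx).eq_of_nhds]
    · simp [laplacian_eq_zero_of_notMem_tsupport hx]
  -- Step 2: Green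
  have e2 : ∫ x, P x * Δ ψ x = ∫ x, Δ P x * ψ x :=
    integral_mul_laplacian_eq_integral_laplacian_mul (contDiff_infty.1 hPs 2)
      (contDiff_infty.1 hψ 2) hψc
  -- Step 3: the pressure Poisson equation on `supp ψ`, transported to the globalised fields
  have e3 : ∫ x, Δ P x * ψ x = -∫ x, ψ x * VectorCalculus.divergence (convect V V) x := by
    rw [← integral_neg]
    refine integral_congr_ae (Eventually.of_forall fun x => ?_)
    beta_reduce
    by_cases hx : x ∈ tsupport ψ
    · have hΔ : Δ P x = Δ (p t) x := (InnerProductSpace.laplacian_congr_nhds (hPg x hx)).eq_of_nhds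
      have hpp := laplacian_pressure_eq_of_isClassicalNSSolutionOnRegion hO h
        (contDiffOn_const (c := (0 : E))) (hK x hx)
      have hc : VectorCalculus.divergence (convect V V) x =
          VectorCalculus.divergence (convect (u t) (u t)) x := by
        refine divergence_congr_nhds ?_
        have hVg' : ∀ᶠ y in 𝓝 x, V =ᶠ[𝓝 y] u t := eventually_eventuallyEq_nhds.2 (hVg x hx)
        filter_upwards [hVg'] with y hy
        simp only [convect, hy.fderiv_eq, hy.eq_of_nhds]
      have hpp' : Δ (p t) x = -VectorCalculus.divergence (convect (u t) (u t)) x := by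
        rw [hpp]
        have h0 : VectorCalculus.divergence ((0 : ℝ → E → E) t) x = 0 := by
          simp [VectorCalculus.divergence, Pi.zero_def]
        rw [h0, add_zero]
      rw [hΔ, hpp', hc]
      ring
    · simp [image_eq_zero_of_notMem_tsupport hx]
  -- Step 4: `-∫ ψ div((V·∇)V) = ∫ ⟪(V·∇)V, ∇ψ⟫`
  have hV1 : ContDiff ℝ 1 V := hVs.of_le (by exact_mod_cast le_top)
  have hcV : ContDiff ℝ 1 (convect V V) := by
    have : convect V V = fun y => fderiv ℝ V y (V y) := rfl
    rw [this]
    exact ((contDiff_infty_iff_fderiv.1 hVs).2.of_le (by exact_mod_cast le_top)).clm_apply hV1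
  have e4 : -∫ x, ψ x * VectorCalculus.divergence (convect V V) x =
      ∫ x, ⟪convect V V x, gradient ψ x⟫ := by
    have := integral_mul_divergence_add_eq_zero_left (hψ.of_le (by exact_mod_cast le_top)) hcV hψc
    linarith
  -- Step 5: the trilinear identity, and back to `u t`
  have hdivV : ∀ x ∈ tsupport ψ, VectorCalculus.divergence V x = 0 := fun x hx => by
    rw [divergence_congr_nhds (hVg x hx)]
    exact h.divFree t x (hK x hx)
  have e5 := integral_inner_convect_gradient_eq_neg hV1 hψ hψc hdivV
  have e6 : ∫ x, fderiv ℝ (fderiv ℝ ψ) x (V x) (V x) =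
      ∫ x, fderiv ℝ (fderiv ℝ ψ) x (u t x) (u t x) := by
    refine integral_congr_ae (Eventually.of_forall fun x => ?_)
    beta_reduce
    by_cases hx : x ∈ tsupport ψ
    · rw [(hVg x hx).eq_of_nhds]
    · have h0 : fderiv ℝ (fderiv ℝ ψ) x = 0 :=
        fderiv_of_notMem_tsupport ℝ fun h' => hx (tsupport_fderiv_subset ℝ h')
      simp [h0]
  rw [e1, e2, e3, e4, e5, e6]

end Literature.Analysis.FluidPDE

end
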